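import Summits.QuantumFields.BalabanUV.Beta.GAN24.VolumeLimitPairsFibre
import Summits.QuantumFields.BalabanUV.Beta.GAN24.FinePropagatorDecay

/-!
# `BalabanUV.Beta.GAN24.FineInsertionVolumeLimit` — binder row G-an2-4 ∕ (CONV-C), route R7 «TWO CURRENCIES», PART 146: THE u-DERIVATIVE SECTOR's FINE-LEVEL INSERTION `𝒢^{(k)}P𝒢^{(k)}` AND
# ITS AVERAGING `L^{dk}Q_k(𝒢P𝒢)Q_kᴴ` HAVE PAIR ENTRY LIMITS, MODULO ONLY THE INSERTION's — for ANY volume-indexed family of fine-level kernels `P_t` on the fine torus of the even cubic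
# volumes with a volume-uniform entry bound and pair entry limits at fine integer readings (EL₂ — the background's volume limit, DISPLAYED): PART 144's pair products on the fine torus
# `Site d (n_k·2(t+1)) × Fin d` (`Tor (fine n_k (cubic d s)) = Site d (n_k s)` definitionally) with PART 145's window decay of `𝒢^{(k)}` and the β-cell row an5's `calG_tendsto_Kinf` as the
# EL₂ of `𝒢^{(k)}`; then PART 138's `QvOp` stencil (`QGQ_apply`, generic in the middle kernel) turns the averaged insertion's unit entries into FIXED finite combinations of fine entries.  With
# PART 143's u-derivative socket this is the EL₂ input of `Σ̇_k = −c_k⁻¹ċ_kc_k⁻¹` (census V182) (unit b2b-balaban-gan24-p3, gen 54; v1)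

NOT IN PRINT; OUR PROOF ([folklore] bookkeeping BY NAME over PART 144 (`tendsto_mul_pair`, `tendsto_mul_pair'`), PART 145 (`exists_fineWindowDecay_calGlev`), PART 142 (`l1_windowMap_neg`),
PART 138 (`QGQ_apply`, `bpt_castT_add_tstep`), NE2's `Atow_QBlev_eq_submatrix`, the β-cell's `VectorPropagatorLimit.calG_tendsto_Kinf`, `B12Sec2to5.summable_exp_neg_l1`,
`InfiniteVolume.windowMap_injective`; [Balaban1987RG1] p. 264 LOCATES the `T ↗ ℤ^d` limit; nothing printed is a hypothesis).
HONEST FRAMING (cell contract, verbatim): «discharging `BetaPertH` makes Bałaban's UV stability UNCONDITIONAL — a real constructive-QFT result; it is NOT the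
continuum limit and NOT the Clay problem.»  HONEST DEPENDENCY (verbatim): «continuum YM on T⁴ ⇐ BetaPertH ∧ nine spine estimates (0/9 proved); BetaPertH ⇐
(D1) ∧ (D4) ∧ CAP+tail; G-an2-4 gates asym, D1 and NE2/3/4.»

WHAT THIS FILE PROVES (0 sorry, 0 `def`; `n = n_k = L^k`, fine torus `Site d (n·s) × Fin d`, `ẑ = castT (cubic d (n·s)) z`):
* §1 `sum_exp_window_le_tsum` (`Σ_{w ∈ (ℤ∕s)^d} e^{−δ|windowMap(w − x)|₁} ≤ Σ'_{y ∈ ℤ^d} e^{−δ|y|₁}`), **`norm_mul_apply_le_of_window`** (a window-decaying kernel times a bounded one is bounded,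
  volume-free: `‖(G·P)((x,f),(y,h))‖ ≤ C·B·|F|·S_δ`).
* §2 `tendsto_calGlev_pair` (EL₂ of `𝒢^{(k)}` on the fine torus of the even cubic volumes, `d ≥ 3` — an5's theorem re-read), **`tendsto_GPG_pair`** — EL₂ OF THE FINE INSERTION `𝒢^{(k)}·P_t·𝒢^{(k)}`
  from a volume-uniform bound `‖P_t‖_entries ≤ B` and EL₂ of `P_t` (DISPLAYED).
* §3 `reindex_avgTow_eq` (`avgTow QBlev (L^d) X k` read on `Tor M × Fin d` is `(L^d)^k•(Q_k X_k Q_kᴴ)`), **`tendsto_avgInsertion_pair`** — EL₂ AT UNIT PAIRS of the averaged insertion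
  `avgTow QBlev (L^d) (k ↦ 𝒢^{(k)}P_t𝒢^{(k)}) k` (PART 138's stencil: a fixed finite combination of §2's limits) — the EL₂ input of PART 143's `conv_insertion_invCov_of_kernel`.
WHAT IT DOES NOT DO: the (UD)+(SR) inputs of the socket for this insertion (PART 126 ∕ 128's `decayStations_…` supply them for `P = Pmodel V` under `LipschitzBackground`; the assembly of
`Σ̇_k`'s END is the successor's one file); verify EL₂ for `Pmodel V_t` (needs the background's volume limit — external); `d ≤ 2`; odd volumes.  SUPPLIER work; NEVER «G-an2-4 closed»;
NOT (CONV-C), NOT D1, NOT `BetaPertH`, NOT continuum, NOT Clay.  Records: `HOME/b2b-balaban-gan24-p3/gen54/README.md`.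
-/

noncomputable section

open scoped BigOperators ComplexConjugate Matrix Matrix.Norms.L2Operator
open Filter Topology

namespace Summit.QuantumFields.BalabanUV.Beta.GAN24.FineInsertionVolumeLimit

open Literature.MathematicalPhysics.QuantumFieldTheory.Balaban1983to89
open Literature.MathematicalPhysics.QuantumFieldTheory.Balaban1983to89.B5Prop11Plancherel (Tor fine calG)
open Literature.MathematicalPhysics.QuantumFieldTheory.Balaban1983to89.B5Block118 (QvOp bpt tstep)
open Literature.MathematicalPhysics.QuantumFieldTheory.Balaban1983to89.B5G183RateUnitTower (lev)
open Literature.MathematicalPhysics.QuantumFieldTheory.Balaban1983to89.B12Sec2to5 (l1 summable_exp_neg_l1)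
open Literature.MathematicalPhysics.QuantumFieldTheory.Balaban1983to89.Beta (Site windowMap InWindow siteOf windowMap_injective inWindow_windowMap siteOf_windowMap windowMap_siteOf)
open Literature.MathematicalPhysics.QuantumFieldTheory.Balaban1983to89.Beta.FreeLegDictionary (cubic)
open Literature.MathematicalPhysics.QuantumFieldTheory.Balaban1983to89.Beta.BlockKernelVolumeSockets (evenPeriod tendsto_evenPeriod)
open Literature.MathematicalPhysics.QuantumFieldTheory.Balaban1983to89.Beta.VectorTails (castT)
open Literature.MathematicalPhysics.QuantumFieldTheory.Balaban1983to89.Beta.VectorPropagatorLimit (Kinf calG_tendsto_Kinf)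
open Summit.QuantumFields.BalabanUV.T4Continuum
open Summit.QuantumFields.BalabanUV.T4Continuum.CovariantAveragingTower (Atow avgTow)
open Summit.QuantumFields.BalabanUV.T4Continuum.BalabanAveragedTowerUnit (idx QBlev calGlev one_le_lev')
open Summit.QuantumFields.BalabanUV.T4Continuum.BalabanAveragedCoerciveTower (unitIdx Atow_QBlev_eq_submatrix)
open Summit.QuantumFields.BalabanUV.Beta.GAN24.VolumeLimitCovariance (QGQ_apply bpt_castT_add_tstep)
open Summit.QuantumFields.BalabanUV.Beta.GAN24.DiagramVolumeLimitPairs (l1_windowMap_neg)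
open Summit.QuantumFields.BalabanUV.Beta.GAN24.VolumeLimitPairsFibre (tendsto_mul_pair tendsto_mul_pair')
open Summit.QuantumFields.BalabanUV.Beta.GAN24.FinePropagatorDecay (exists_fineWindowDecay_calGlev)

variable {d : ℕ} (L : ℕ) [NeZero L]

/-! ## §1 Row sums of window-decaying kernels; bounded × decaying is bounded -/

section RowSums

variable {F : Type*} [Fintype F]

/-- `Σ_{w ∈ (ℤ∕s)^d} e^{−δ|windowMap(w − x)|₁} ≤ Σ'_{y ∈ ℤ^d} e^{−δ|y|₁}` (`δ > 0`; translate, then the window injects into `ℤ^d`). [folklore] -/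
theorem sum_exp_window_le_tsum (s : ℕ) [NeZero s] {δ : ℝ} (hδ : 0 < δ) (x : Site d s) :
    ∑ w : Site d s, Real.exp (-δ * l1 (windowMap d s (w - x))) ≤ ∑' y : Fin d → ℤ, Real.exp (-δ * l1 y) := by
  classical
  have e1 : ∑ w : Site d s, Real.exp (-δ * l1 (windowMap d s (w - x))) = ∑ w : Site d s, Real.exp (-δ * l1 (windowMap d s w)) :=
    Fintype.sum_equiv (Equiv.subRight x) _ _ fun w => rfl
  rw [e1]
  have e2 : ∑ w : Site d s, Real.exp (-δ * l1 (windowMap d s w)) = ∑ y ∈ Finset.univ.image (windowMap d s), Real.exp (-δ * l1 y) := by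
    rw [Finset.sum_image fun w _ w' _ h => windowMap_injective d s h]
  rw [e2]
  exact (summable_exp_neg_l1 hδ d).sum_le_tsum _ fun y _ => (Real.exp_pos _).le

/-- **a window-decaying kernel times an entrywise bounded one is entrywise bounded, volume-free**: `‖G((x,f),(w,g))‖ ≤ C·e^{−δ|windowMap(w − x)|₁}`, `‖P((w,g),(y,h))‖ ≤ B` ⟹
`‖(G·P)((x,f),(y,h))‖ ≤ C·B·|F|·Σ'_y e^{−δ|y|₁}`. [folklore] -/
theorem norm_mul_apply_le_of_window (s : ℕ) [NeZero s] {G P : Matrix (Site d s × F) (Site d s × F) ℂ} {C B δ : ℝ} (hδ : 0 < δ) (hC : 0 ≤ C) (hB : 0 ≤ B)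
    (hG : ∀ (x : Site d s) (f : F) (w : Site d s) (g : F), ‖G (x, f) (w, g)‖ ≤ C * Real.exp (-δ * l1 (windowMap d s (w - x))))
    (hP : ∀ (w : Site d s) (g : F) (y : Site d s) (h : F), ‖P (w, g) (y, h)‖ ≤ B) (x : Site d s) (f : F) (y : Site d s) (h : F) :
    ‖(G * P) (x, f) (y, h)‖ ≤ C * B * (Fintype.card F * ∑' y : Fin d → ℤ, Real.exp (-δ * l1 y)) := by
  rw [Matrix.mul_apply, Fintype.sum_prod_type, Finset.sum_comm]
  calc ‖∑ g : F, ∑ w : Site d s, G (x, f) (w, g) * P (w, g) (y, h)‖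
      ≤ ∑ g : F, ∑ w : Site d s, ‖G (x, f) (w, g) * P (w, g) (y, h)‖ := (norm_sum_le _ _).trans (Finset.sum_le_sum fun g _ => norm_sum_le _ _)
    _ ≤ ∑ _g : F, ∑ w : Site d s, C * B * Real.exp (-δ * l1 (windowMap d s (w - x))) := by
        refine Finset.sum_le_sum fun g _ => Finset.sum_le_sum fun w _ => ?_
        rw [norm_mul]
        calc ‖G (x, f) (w, g)‖ * ‖P (w, g) (y, h)‖ ≤ (C * Real.exp (-δ * l1 (windowMap d s (w - x)))) * B :=
              mul_le_mul (hG x f w g) (hP w g y h) (norm_nonneg _) (by positivity)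
          _ = C * B * Real.exp (-δ * l1 (windowMap d s (w - x))) := by ring
    _ ≤ ∑ _g : F, C * B * ∑' y : Fin d → ℤ, Real.exp (-δ * l1 y) := by
        refine Finset.sum_le_sum fun g _ => ?_
        rw [← Finset.mul_sum]
        exact mul_le_mul_of_nonneg_left (sum_exp_window_le_tsum s hδ x) (by positivity)
    _ = C * B * (Fintype.card F * ∑' y : Fin d → ℤ, Real.exp (-δ * l1 y)) := by
        rw [Finset.sum_const, Finset.card_univ, nsmul_eq_mul]; ring

end RowSums

/-! ## §2 Pair entry limits of the fine insertion `𝒢^{(k)}·P·𝒢^{(k)}` on the even cubic volumes -/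

variable (a : ℝ) (ha : 0 < a)

/-- **EL₂ of the fine propagator** on the fine tori `Site d (n_k·2(t+1)) × Fin d` of the even cubic volumes (`d ≥ 3`): the β-cell row an5's `calG_tendsto_Kinf`, read without the prefactor `n²`.
[cite: Balaban1987RG1, p.264 (after (1.21): the `T ↗ ℤ^d` limit)] -/
theorem tendsto_calGlev_pair (hd : 3 ≤ d) (k : ℕ) (μ ν : Fin d) (z z' : Fin d → ℤ) :
    ∃ s : ℂ, Tendsto (fun t => calGlev L (cubic d (evenPeriod t)) a ha k (castT (cubic d (lev L k * evenPeriod t)) z, μ) (castT (cubic d (lev L k * evenPeriod t)) z', ν)) atTop (𝓝 s) := by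
  have hn2 : (((lev L k : ℕ) : ℂ) ^ 2) ≠ 0 := pow_ne_zero _ (by exact_mod_cast (NeZero.ne (lev L k)))
  have h := (calG_tendsto_Kinf (lev L k) (one_le_lev' L k) a ha hd z z' μ ν).const_mul ((((lev L k : ℕ) : ℂ) ^ 2)⁻¹)
  refine ⟨_, h.congr fun t => ?_⟩
  rw [inv_mul_cancel_left₀ hn2]; rfl

/-- **`tendsto_GPG_pair` — EL₂ OF THE FINE INSERTION, MODULO THE INSERTION's** [our proof] (`d ≥ 3`, any `L ≥ 1`, `a > 0`, level `k`, `n = L^k`): for a volume-indexed family `P_t` of kernels on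
the fine tori of the even cubic volumes with a volume-uniform entry bound `‖P_t((w,g),(y,h))‖ ≤ B` and pair entry limits at fine integer readings (EL₂ — DISPLAYED), the fine insertion
`𝒢^{(k)}·P_t·𝒢^{(k)}` has pair entry limits at fine integer readings: PART 144's `tendsto_mul_pair'` (`𝒢` decays on the left, PART 145) then `tendsto_mul_pair` (`𝒢P` bounded by §1, `𝒢` decays
on the right), with `tendsto_calGlev_pair` as the EL₂ of `𝒢`. -/
theorem tendsto_GPG_pair (hd : 3 ≤ d) (k : ℕ) {P : (t : ℕ) → (k' : ℕ) → Matrix (idx L (cubic d (evenPeriod t)) k') (idx L (cubic d (evenPeriod t)) k') ℂ} {B : ℝ} (hB : 0 ≤ B)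
    (hPb : ∀ t (w : Site d (lev L k * evenPeriod t)) (g : Fin d) (y : Site d (lev L k * evenPeriod t)) (h : Fin d), ‖P t k (w, g) (y, h)‖ ≤ B)
    (hPel : ∀ (f g : Fin d) (z z' : Fin d → ℤ), ∃ s : ℂ,
      Tendsto (fun t => P t k (castT (cubic d (lev L k * evenPeriod t)) z, f) (castT (cubic d (lev L k * evenPeriod t)) z', g)) atTop (𝓝 s))
    (μ ν : Fin d) (z z' : Fin d → ℤ) :
    ∃ s : ℂ, Tendsto (fun t => (calGlev L (cubic d (evenPeriod t)) a ha k * P t k * calGlev L (cubic d (evenPeriod t)) a ha k)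
      (castT (cubic d (lev L k * evenPeriod t)) z, μ) (castT (cubic d (lev L k * evenPeriod t)) z', ν)) atTop (𝓝 s) := by
  have hd1 : 1 ≤ d := le_trans (by norm_num) hd
  have hd0 : (0 : ℝ) < d := by exact_mod_cast lt_of_lt_of_le zero_lt_one hd1
  have hn : (0 : ℝ) < lev L k := by exact_mod_cast Nat.pos_of_ne_zero (NeZero.ne (lev L k))
  have hside : Tendsto (fun t => lev L k * evenPeriod t) atTop atTop :=
    Filter.Tendsto.const_mul_atTop' (Nat.pos_of_ne_zero (NeZero.ne (lev L k))) tendsto_evenPeriod |>.congr fun t => by ring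
  obtain ⟨κ, C, hκ, hC, hdec⟩ := exists_fineWindowDecay_calGlev L a ha
  have hδ : 0 < κ / (d * lev L k) := div_pos hκ (mul_pos hd0 hn)
  -- window decay of `𝒢` on the right and on the left
  have hGr : ∀ t (w : Site d (lev L k * evenPeriod t)) (g : Fin d) (y : Site d (lev L k * evenPeriod t)) (h : Fin d),
      ‖calGlev L (cubic d (evenPeriod t)) a ha k (w, g) (y, h)‖ ≤ C * Real.exp (-(κ / (d * lev L k)) * l1 (windowMap d (lev L k * evenPeriod t) (w - y))) :=
    fun t w g y h => hdec (evenPeriod t) k w y g h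
  have hGl : ∀ t (x : Site d (lev L k * evenPeriod t)) (f : Fin d) (w : Site d (lev L k * evenPeriod t)) (g : Fin d),
      ‖calGlev L (cubic d (evenPeriod t)) a ha k (x, f) (w, g)‖ ≤ C * Real.exp (-(κ / (d * lev L k)) * l1 (windowMap d (lev L k * evenPeriod t) (w - x))) := by
    intro t x f w g
    have h := hdec (evenPeriod t) k x w f g
    rwa [show x - w = -(w - x) from (neg_sub w x).symm, l1_windowMap_neg] at h
  have hGb : ∀ t (w : Site d (lev L k * evenPeriod t)) (g : Fin d) (y : Site d (lev L k * evenPeriod t)) (h : Fin d),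
      ‖calGlev L (cubic d (evenPeriod t)) a ha k (w, g) (y, h)‖ ≤ C := by
    intro t w g y h
    refine (hGr t w g y h).trans ?_
    have : Real.exp (-(κ / (d * lev L k)) * l1 (windowMap d (lev L k * evenPeriod t) (w - y))) ≤ 1 := by
      rw [Real.exp_le_one_iff, neg_mul, neg_nonpos]; exact mul_nonneg hδ.le (Finset.sum_nonneg fun i _ => abs_nonneg _)
    simpa using mul_le_mul_of_nonneg_left this hC
  have hGel := fun f g u u' => tendsto_calGlev_pair L a ha hd k f g u u'
  -- `𝒢·P`: EL₂ (left factor decaying) and the volume-free bound of §1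
  have hGP := tendsto_mul_pair' (d := d) (F := Fin d) (side := fun t => lev L k * evenPeriod t) hside
    (X := fun t => calGlev L (cubic d (evenPeriod t)) a ha k) (Y := fun t => P t k) hGl hδ hPb hGel hPel
  have hGPb : ∀ t (x : Site d (lev L k * evenPeriod t)) (f : Fin d) (w : Site d (lev L k * evenPeriod t)) (g : Fin d),
      ‖(calGlev L (cubic d (evenPeriod t)) a ha k * P t k) (x, f) (w, g)‖ ≤ C * B * (Fintype.card (Fin d) * ∑' y : Fin d → ℤ, Real.exp (-(κ / (d * lev L k)) * l1 y)) :=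
    fun t x f w g => norm_mul_apply_le_of_window (lev L k * evenPeriod t) hδ hC hB (hGl t) (hPb t) x f w g
  exact tendsto_mul_pair (d := d) (F := Fin d) (side := fun t => lev L k * evenPeriod t) hside
    (X := fun t => calGlev L (cubic d (evenPeriod t)) a ha k * P t k) (Y := fun t => calGlev L (cubic d (evenPeriod t)) a ha k) hGPb hGr hδ hGP hGel μ ν z z'

/-! ## §3 The averaged insertion on the unit lattice: pair entry limits -/

/-- `avgTow QBlev (L^d) X k` READ ON `Tor M × Fin d` IS `(L^d)^k·(Q_k X_k Q_kᴴ)` with `Q_k = QvOp (L^k) M` (`Atow_QBlev_eq_submatrix`; PART 138's `reindex_unitCovB_eq` for a general middle kernel).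
[cite: Balaban1984PropagatorsI, (1.18) p.20 (the object)] -/
theorem reindex_avgTow_eq (M : Fin d → ℕ) [∀ μ, NeZero (M μ)] (X : (k : ℕ) → Matrix (idx L M k) (idx L M k) ℂ) (k : ℕ) :
    Matrix.reindex (unitIdx L M) (unitIdx L M) (avgTow (QBlev L M) ((L : ℝ) ^ d) X k)
      = ((((L : ℝ) ^ d) ^ k : ℝ) : ℂ) • (QvOp (lev L k) M * X k * (QvOp (lev L k) M)ᴴ) := by
  have e : avgTow (QBlev L M) ((L : ℝ) ^ d) X k = ((((L : ℝ) ^ d) ^ k : ℝ) : ℂ) • (Atow (QBlev L M) k * X k * (Atow (QBlev L M) k)ᴴ) := by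
    unfold avgTow; push_cast; rfl
  rw [e, Atow_QBlev_eq_submatrix]
  ext b b'
  simp only [Matrix.reindex_apply, Matrix.submatrix_apply, Matrix.smul_apply, Matrix.mul_apply, Matrix.conjTranspose_apply, Equiv.apply_symm_apply, id]

/-- **`tendsto_avgInsertion_pair` — THE AVERAGED INSERTION's PAIR ENTRY LIMITS ON THE UNIT LATTICE, MODULO THE INSERTION's** [our proof] (`d ≥ 3`, `a > 0`, level `k`): under the hypotheses
of `tendsto_GPG_pair` on `P_t`, the unit-lattice tower `X_t k = avgTow QBlev (L^d) (k ↦ 𝒢^{(k)}P_t𝒢^{(k)}) k` read through `e = unitIdx⁻¹` has pair entry limits at integer sites: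
`∀ μ ν z z′, ∃ s, X_t k (e(ẑ,μ)) (e(ẑ′,ν)) → s` — every entry is a FIXED finite combination (PART 138's `QvOp` stencil) of fine-insertion entries at fine integer readings.  This is the EL₂ input
of PART 143's `conv_insertion_invCov_of_kernel` for the u-derivative sector. [cite: Balaban1987RG1, p.264 (the `T ↗ ℤ^d` limit)] -/
theorem tendsto_avgInsertion_pair (hd : 3 ≤ d) (k : ℕ) {P : (t : ℕ) → (k' : ℕ) → Matrix (idx L (cubic d (evenPeriod t)) k') (idx L (cubic d (evenPeriod t)) k') ℂ} {B : ℝ}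
    (hB : 0 ≤ B) (hPb : ∀ t (w : Site d (lev L k * evenPeriod t)) (g : Fin d) (y : Site d (lev L k * evenPeriod t)) (h : Fin d), ‖P t k (w, g) (y, h)‖ ≤ B)
    (hPel : ∀ (f g : Fin d) (z z' : Fin d → ℤ), ∃ s : ℂ,
      Tendsto (fun t => P t k (castT (cubic d (lev L k * evenPeriod t)) z, f) (castT (cubic d (lev L k * evenPeriod t)) z', g)) atTop (𝓝 s))
    (μ ν : Fin d) (z z' : Fin d → ℤ) :
    ∃ s : ℂ, Tendsto (fun t => Matrix.reindex (unitIdx L (cubic d (evenPeriod t))) (unitIdx L (cubic d (evenPeriod t)))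
        (avgTow (QBlev L (cubic d (evenPeriod t))) ((L : ℝ) ^ d)
          (fun k' => calGlev L (cubic d (evenPeriod t)) a ha k' * P t k' * calGlev L (cubic d (evenPeriod t)) a ha k') k)
        (castT (cubic d (evenPeriod t)) z, μ) (castT (cubic d (evenPeriod t)) z', ν)) atTop (𝓝 s) := by
  -- each stencil term converges
  have hterm : ∀ (j : Fin d → Fin (lev L k)) (t₁ : Fin (lev L k)) (j' : Fin d → Fin (lev L k)) (t₂ : Fin (lev L k)), ∃ s : ℂ,
      Tendsto (fun t => (calGlev L (cubic d (evenPeriod t)) a ha k * P t k * calGlev L (cubic d (evenPeriod t)) a ha k)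
          (bpt (lev L k) (cubic d (evenPeriod t)) (castT (cubic d (evenPeriod t)) z) j + tstep (fine (lev L k) (cubic d (evenPeriod t))) μ t₁, μ)
          (bpt (lev L k) (cubic d (evenPeriod t)) (castT (cubic d (evenPeriod t)) z') j' + tstep (fine (lev L k) (cubic d (evenPeriod t))) ν t₂, ν)) atTop (𝓝 s) := by
    intro j t₁ j' t₂
    obtain ⟨s, hs⟩ := tendsto_GPG_pair L a ha hd k hB hPb hPel μ ν
      (fun i => (lev L k : ℤ) * z i + ((j i : ℕ) : ℤ) + if i = μ then ((t₁ : ℕ) : ℤ) else 0)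
      (fun i => (lev L k : ℤ) * z' i + ((j' i : ℕ) : ℤ) + if i = ν then ((t₂ : ℕ) : ℤ) else 0)
    refine ⟨s, hs.congr fun t => ?_⟩
    rw [bpt_castT_add_tstep, bpt_castT_add_tstep]
  choose sv hsv using hterm
  refine ⟨_, (Tendsto.const_mul (((((L : ℝ) ^ d) ^ k : ℝ) : ℂ) * (1 / ((lev L k : ℕ) : ℂ) ^ (d + 1) * (1 / ((lev L k : ℕ) : ℂ) ^ (d + 1))))
    (tendsto_finsetSum Finset.univ fun j _ => tendsto_finsetSum Finset.univ fun t₁ _ => tendsto_finsetSum Finset.univ fun j' _ =>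
      tendsto_finsetSum Finset.univ fun t₂ _ => hsv j t₁ j' t₂)).congr fun t => ?_⟩
  rw [reindex_avgTow_eq, Matrix.smul_apply, smul_eq_mul, QGQ_apply]
  ring

end Summit.QuantumFields.BalabanUV.Beta.GAN24.FineInsertionVolumeLimit

end
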